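import Summits.AnomalousDissipation.AnomalousDissipation.Theorems.QuarticGate.Negative.LevelCeiling
import Literature.Analysis.FunctionSpaces.TorusFluidGlueProofs
import Literature.Analysis.FunctionSpaces.TorusCalculusProofs

/-!
# Negative knowledge for the crux `MomentParity.QuarticGate` (stmt-AnomalousDissipation-11464):
# load-bearing analysis III — the laminar Kolmogorov Dirac family

Certified copy of section D of the cdisprove work file `Cruxes/QuarticGate/Disproof.lean`
(refuter-cdisprove-stmt-AnomalousDissipation-11464-0, cycle 1). Supports stmt-AnomalousDissipation-11464; no
positive route-item statement is asserted.

* `kolField a = a cos(2πx₁) e₀` (`realTrigPoly` on `{±e₁}`), smooth, solenoidal, mean zero, `ΔK = −4π²K`,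
  `(K·∇)K = 0`; `kolState a` its class in `H`.
* `nsGeneratorPairing_kolField` — `⟨F(K_a), w⟩ = 0` for every smooth `w` at force `4π²νK_a` (exact steady state).
* `isPolyStationary_dirac_kolState` — `δ_{[K_a]}` is polynomially stationary at EVERY order and level.
* `isQuarticWitness_dirac_kolState` — with `a = (4π²ν)⁻¹` it is a witness for the fixed force `K_1` at every level
  `N ≥ 1` (energy `a²/2`, dissipation `(8π²ν)⁻¹`) and ATTAINS the force floor `ε ≤ ‖f‖₂√E` of `EnergyRow.lean`.
* `quarticGateWithoutEnergyCeiling_holds` — the weakening of `QuarticGate` without `ensembleEnergy μ ≤ E` (even with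
  stationarity at every order) HOLDS: the energy ceiling is load-bearing.
-/

namespace Summit.AnomalousDissipation.AnomalousDissipation.Theorems.QuarticGate.Negative

open MeasureTheory Filter Topology
open scoped ENNReal InnerProductSpace RealInnerProductSpace
open Literature.Analysis.FunctionSpaces Literature.Analysis.FluidPDE
open Summit.AnomalousDissipation.AnomalousDissipation.Theses.MomentParity

noncomputable section

/-! ## D. The laminar Kolmogorov family: the energy ceiling is load-bearing, and (C) is tight -/

section Laminar

/-- Local notation for the real Hilbert space `L²(T³; ℝ³)`. -/
local notation "L2T3" => Lp (EuclideanSpace ℝ (Fin 3)) 2 (volume : Measure (UnitAddTorus (Fin 3)))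

/-- The Kolmogorov frequency `e₁ = (0,1,0)`. -/
def kolFreq : Fin 3 → ℤ := Pi.single 1 1

/-- The symmetric frequency pair `{e₁, −e₁}`. -/
def kolSet : Finset (Fin 3 → ℤ) := {kolFreq, -kolFreq}

/-- The coefficient family of `a cos(2πx₁) e₀`: the constant `(a/2) e₀`. -/
def kolCoeff (a : ℝ) : (Fin 3 → ℤ) → EuclideanSpace ℂ (Fin 3) :=
  fun _ => ((a / 2 : ℝ) : ℂ) • EuclideanSpace.complexify (EuclideanSpace.single (0 : Fin 3) (1 : ℝ))

/-- The Kolmogorov (laminar shear) field `K_a(x) = a cos(2πx₁) e₀` on `T³`. -/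
def kolField (a : ℝ) : UnitAddTorus (Fin 3) → EuclideanSpace ℝ (Fin 3) :=
  Torus.realTrigPoly kolSet (kolCoeff a)

/-- `kolFreq_ne_zero` (bookkeeping for the laminar family). [folklore] -/
theorem kolFreq_ne_zero : kolFreq ≠ 0 := fun h => by
  have := congrFun h 1; simp [kolFreq] at this

/-- `kolFreq_apply_zero` (bookkeeping for the laminar family). [folklore] -/
theorem kolFreq_apply_zero : kolFreq 0 = 0 := by simp [kolFreq]

/-- `freqNormSq_kolFreq` (bookkeeping for the laminar family). [folklore] -/
theorem freqNormSq_kolFreq : Torus.freqNormSq kolFreq = 1 := by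
  simp [Torus.freqNormSq, kolFreq, Fin.sum_univ_three]

/-- `neg_mem_kolSet` (bookkeeping for the laminar family). [folklore] -/
theorem neg_mem_kolSet : ∀ k ∈ kolSet, -k ∈ kolSet := by
  intro k hk
  simp only [kolSet, Finset.mem_insert, Finset.mem_singleton] at hk ⊢
  rcases hk with rfl | rfl <;> simp

/-- `freqNormSq_of_mem_kolSet` (bookkeeping for the laminar family). [folklore] -/
theorem freqNormSq_of_mem_kolSet {k : Fin 3 → ℤ} (hk : k ∈ kolSet) : Torus.freqNormSq k = 1 := by
  simp only [kolSet, Finset.mem_insert, Finset.mem_singleton] at hk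
  rcases hk with rfl | rfl
  · exact freqNormSq_kolFreq
  · rw [Torus.freqNormSq_neg]; exact freqNormSq_kolFreq

/-- `ne_zero_of_mem_kolSet` (bookkeeping for the laminar family). [folklore] -/
theorem ne_zero_of_mem_kolSet {k : Fin 3 → ℤ} (hk : k ∈ kolSet) : k ≠ 0 := by
  intro h; subst h
  have := freqNormSq_of_mem_kolSet hk
  rw [Torus.freqNormSq_zero] at this
  exact zero_ne_one this

/-- `apply_zero_of_mem_kolSet` (bookkeeping for the laminar family). [folklore] -/
theorem apply_zero_of_mem_kolSet {k : Fin 3 → ℤ} (hk : k ∈ kolSet) : k 0 = 0 := by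
  simp only [kolSet, Finset.mem_insert, Finset.mem_singleton] at hk
  rcases hk with rfl | rfl <;> simp [kolFreq]

/-- `isConjSymm_kolCoeff` (bookkeeping for the laminar family). [folklore] -/
theorem isConjSymm_kolCoeff (a : ℝ) : Torus.IsConjSymm (kolCoeff a) := by
  intro k
  simp only [kolCoeff]
  rw [EuclideanSpace.conjVec_smul, EuclideanSpace.conjVec_complexify, Complex.conj_ofReal]

/-- `isTransversal_kolCoeff` (bookkeeping for the laminar family). [folklore] -/
theorem isTransversal_kolCoeff (a : ℝ) : Torus.IsTransversal kolSet (kolCoeff a) := by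
  intro k hk
  simp [kolCoeff, EuclideanSpace.complexify_apply, Fin.sum_univ_three, apply_zero_of_mem_kolSet hk]

/-- `norm_kolCoeff` (bookkeeping for the laminar family). [folklore] -/
theorem norm_kolCoeff (a : ℝ) (k : Fin 3 → ℤ) : ‖kolCoeff a k‖ = |a| / 2 := by
  simp only [kolCoeff, norm_smul, Complex.norm_real, Real.norm_eq_abs,
    EuclideanSpace.norm_complexify, PiLp.norm_single, norm_one, mul_one, abs_div,
    abs_two]

/-- `kolCoeff_mul` (bookkeeping for the laminar family). [folklore] -/
theorem kolCoeff_mul (r a : ℝ) : kolCoeff (r * a) = fun k => ((r : ℝ) : ℂ) • kolCoeff a k := by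
  funext k
  simp only [kolCoeff, smul_smul, ← Complex.ofReal_mul]
  ring_nf

/-- `K_a` is smooth. [folklore] -/
theorem isSmooth_kolField (a : ℝ) : Torus.IsSmooth (kolField a) :=
  Torus.isSmooth_realTrigPoly _ _

/-- `K_a` is divergence free. [folklore] -/
theorem isDivFree_kolField (a : ℝ) : Torus.IsDivFree (kolField a) :=
  Torus.isDivFree_realTrigPoly (isTransversal_kolCoeff a)

/-- `K_a` has zero mean. [folklore] -/
theorem hasZeroMean_kolField (a : ℝ) : Torus.HasZeroMean (kolField a) := by
  unfold Torus.HasZeroMean kolField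
  simp_rw [Torus.realTrigPoly_apply_eq_sum]
  rw [integral_finsetSum _ fun k _ => ?_]
  · refine Finset.sum_eq_zero fun k hk => ?_
    have hi : Integrable (fun x : UnitAddTorus (Fin 3) => UnitAddTorus.mFourier k x • kolCoeff a k) volume :=
      ((UnitAddTorus.mFourier k).continuous.smul continuous_const).integrable_unitAddTorus
    rw [ContinuousLinearMap.integral_comp_comm _ hi, integral_smul_const, Torus.integral_mFourier,
      if_neg (ne_zero_of_mem_kolSet hk), zero_smul, map_zero]
  · exact (EuclideanSpace.realPart.continuous.comp
      ((UnitAddTorus.mFourier k).continuous.smul continuous_const)).integrable_unitAddTorus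

/-- `K_{ra} = r K_a`. [folklore] -/
theorem kolField_mul (r a : ℝ) (x : UnitAddTorus (Fin 3)) : kolField (r * a) x = r • kolField a x := by
  simp only [kolField, Torus.realTrigPoly_apply_eq_sum, kolCoeff_mul, Finset.smul_sum]
  refine Finset.sum_congr rfl fun k _ => ?_
  rw [← map_smul, smul_comm, Complex.coe_smul]

/-- `ΔK_a = −4π² K_a`. [folklore] -/
theorem laplacian_kolField (a : ℝ) (x : UnitAddTorus (Fin 3)) :
    Torus.laplacian (kolField a) x = -(4 * Real.pi ^ 2) • kolField a x := by
  rw [kolField, Torus.laplacian_realTrigPoly, show -(4 * Real.pi ^ 2) • Torus.realTrigPoly kolSet (kolCoeff a) x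
    = kolField (-(4 * Real.pi ^ 2) * a) x from (kolField_mul _ _ x).symm, kolField]
  refine congrFun (Torus.realTrigPoly_congr fun k hk => ?_) x
  rw [kolCoeff_mul, freqNormSq_of_mem_kolSet hk]
  simp

/-- `∂₀ K_a = 0` (the field does not depend on `x₀`). [folklore] -/
theorem partialDeriv_zero_kolField (a : ℝ) : Torus.partialDeriv 0 (kolField a) = 0 := by
  rw [kolField, Torus.partialDeriv_realTrigPoly', ← Torus.realTrigPoly_zero kolSet]
  refine Torus.realTrigPoly_congr fun k hk => ?_
  simp [apply_zero_of_mem_kolSet hk]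

/-- The components `i ≠ 0` of `K_a` vanish. [folklore] -/
theorem kolField_apply_of_ne (a : ℝ) (x : UnitAddTorus (Fin 3)) {i : Fin 3} (hi : i ≠ 0) :
    kolField a x i = 0 := by
  rw [kolField, Torus.realTrigPoly_apply_coord, Torus.trigPoly_apply]
  simp [kolCoeff, EuclideanSpace.complexify_apply, hi.symm]

/-- `(K_a·∇)K_a = 0`: laminar shear has no self-advection. [folklore] -/
theorem convect_kolField_self (a : ℝ) (x : UnitAddTorus (Fin 3)) :
    Torus.convect (kolField a) (kolField a) x = 0 := by
  rw [Torus.convect, Torus.fderiv_apply_eq_sum_partialDeriv ((isSmooth_kolField a).isContDiff (by simp))]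
  refine Finset.sum_eq_zero fun i _ => ?_
  by_cases hi : i = 0
  · subst hi; rw [partialDeriv_zero_kolField]; simp
  · rw [kolField_apply_of_ne a x hi, zero_smul]

/-- **Laminar Kolmogorov flow is an exact steady state at every viscosity**: for every smooth test
field `w`, `⟨F(U), w⟩ = 0` where `U ∈ H` is the class of `K_a` and the force is `4π²ν K_a`
(`νΔK_a + f = 0`, `(K_a·∇)K_a = 0`, and `b(K,K,w) = −b(K,w,K)`). [folklore] -/
theorem nsGeneratorPairing_kolField {ν a : ℝ} {U : Torus.energySpace (Fin 3)}
    (hU : ((U.1 : L2T3) : UnitAddTorus (Fin 3) → EuclideanSpace ℝ (Fin 3)) =ᵐ[volume] kolField a)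
    {w : UnitAddTorus (Fin 3) → EuclideanSpace ℝ (Fin 3)} (hw : Torus.IsSmooth w) :
    Torus.nsGeneratorPairing ν (kolField (4 * Real.pi ^ 2 * ν * a)) U w = 0 := by
  have hK := isSmooth_kolField a
  have hf := isSmooth_kolField (4 * Real.pi ^ 2 * ν * a)
  rw [Torus.nsGeneratorPairing_eq_flux ν (hf.memLp 2) hw hU]
  have hi1 : Integrable (fun x => ⟪kolField a x, Torus.convect (kolField a) w x⟫_ℝ) volume :=
    (hK.continuous.inner (hK.convect hw).continuous).integrable_unitAddTorus
  have hi2 : Integrable (fun x => ν * ⟪kolField a x, Torus.laplacian w x⟫_ℝ) volume :=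
    ((hK.continuous.inner hw.laplacian.continuous).integrable_unitAddTorus).const_mul ν
  have hi3 : Integrable (fun x => ⟪kolField (4 * Real.pi ^ 2 * ν * a) x, w x⟫_ℝ) volume :=
    (hf.continuous.inner hw.continuous).integrable_unitAddTorus
  have hi12 : Integrable (fun x => ⟪kolField a x, Torus.convect (kolField a) w x⟫_ℝ +
      ν * ⟪kolField a x, Torus.laplacian w x⟫_ℝ) volume := hi1.add hi2
  rw [integral_add hi12 hi3, integral_add hi1 hi2, integral_const_mul]
  -- the transport term
  have h1 : ∫ x, ⟪kolField a x, Torus.convect (kolField a) w x⟫_ℝ = 0 := by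
    have h := Torus.integral_inner_convect_add_eq_zero hK (isDivFree_kolField a) hK hw
    have h0 : ∫ x, ⟪Torus.convect (kolField a) (kolField a) x, w x⟫_ℝ = 0 := by
      simp_rw [convect_kolField_self, inner_zero_left, integral_zero]
    linarith
  -- the Stokes term
  have h2 : ∫ x, ⟪kolField a x, Torus.laplacian w x⟫_ℝ = -(4 * Real.pi ^ 2) * ∫ x, ⟪kolField a x, w x⟫_ℝ := by
    rw [← Torus.integral_inner_laplacian_comm hK hw]
    simp_rw [laplacian_kolField, inner_smul_left]
    rw [integral_const_mul]
    simp
  -- the force term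
  have h3 : ∫ x, ⟪kolField (4 * Real.pi ^ 2 * ν * a) x, w x⟫_ℝ =
      (4 * Real.pi ^ 2 * ν) * ∫ x, ⟪kolField a x, w x⟫_ℝ := by
    simp_rw [kolField_mul, inner_smul_left]
    rw [integral_const_mul]
    simp
  rw [h1, h2, h3]
  ring

/-- `kolFreq_ne_neg` (bookkeeping for the laminar family). [folklore] -/
theorem kolFreq_ne_neg : kolFreq ≠ -kolFreq := fun h => by
  have := congrFun h 1; simp [kolFreq] at this

/-- `card_kolSet` (bookkeeping for the laminar family). [folklore] -/
theorem card_kolSet : kolSet.card = 2 := by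
  rw [kolSet, Finset.card_insert_of_notMem (by simpa using kolFreq_ne_neg), Finset.card_singleton]

/-- `‖∇K_a‖² = 2π²a²`. [folklore] -/
theorem toReal_eGradNormSq_kolField (a : ℝ) :
    (Torus.eGradNormSq (kolField a)).toReal = 2 * Real.pi ^ 2 * a ^ 2 := by
  rw [kolField, Torus.toReal_eGradNormSq_realTrigPoly neg_mem_kolSet (isConjSymm_kolCoeff a),
    Finset.sum_congr rfl fun k hk => by rw [freqNormSq_of_mem_kolSet hk, norm_kolCoeff],
    Finset.sum_const, card_kolSet]
  simp only [nsmul_eq_mul, Nat.cast_ofNat, one_mul, div_pow, sq_abs]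
  ring

/-- `∫ ‖K_a‖² = a²/2`. [folklore] -/
theorem integral_norm_sq_kolField (a : ℝ) : ∫ x, ‖kolField a x‖ ^ 2 = a ^ 2 / 2 := by
  rw [kolField, Torus.integral_norm_sq_realTrigPoly neg_mem_kolSet (isConjSymm_kolCoeff a),
    Finset.sum_congr rfl fun k _ => by rw [norm_kolCoeff], Finset.sum_const, card_kolSet]
  simp only [nsmul_eq_mul, Nat.cast_ofNat, div_pow, sq_abs]
  ring

/-- The class of `K_a` in the energy space `H`. -/
def kolState (a : ℝ) : Torus.energySpace (Fin 3) :=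
  ⟨((isSmooth_kolField a).memLp 2).toLp (kolField a),
    Torus.smoothSolenoidal_subset_energySpace ⟨kolField a, isSmooth_kolField a,
      isDivFree_kolField a, hasZeroMean_kolField a, MemLp.coeFn_toLp _⟩⟩

/-- `coe_kolState_ae` (bookkeeping for the laminar family). [folklore] -/
theorem coe_kolState_ae (a : ℝ) :
    (((kolState a).1 : L2T3) : UnitAddTorus (Fin 3) → EuclideanSpace ℝ (Fin 3)) =ᵐ[volume] kolField a :=
  MemLp.coeFn_toLp ((isSmooth_kolField a).memLp 2)

/-- Fourier coefficients only see the a.e. class. [folklore] -/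
theorem mFourierCoeff_congr_ae {v w : UnitAddTorus (Fin 3) → EuclideanSpace ℝ (Fin 3)}
    (h : v =ᵐ[volume] w) (k : Fin 3 → ℤ) :
    UnitAddTorus.mFourierCoeff (EuclideanSpace.complexify ∘ v) k =
      UnitAddTorus.mFourierCoeff (EuclideanSpace.complexify ∘ w) k := by
  rw [Torus.mFourierCoeff_eq_integral_volume, Torus.mFourierCoeff_eq_integral_volume]
  exact integral_congr_ae (h.mono fun x hx => by simp [hx])

/-- The spectral enstrophy only sees the a.e. class. [folklore] -/
theorem eGradNormSq_congr_ae {v w : UnitAddTorus (Fin 3) → EuclideanSpace ℝ (Fin 3)}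
    (h : v =ᵐ[volume] w) : Torus.eGradNormSq v = Torus.eGradNormSq w := by
  rw [Torus.eGradNormSq_eq_tsum, Torus.eGradNormSq_eq_tsum]
  simp_rw [mFourierCoeff_congr_ae h]

/-- `K_a` is a level-`1` (hence level-`N`, `N ≥ 1`) field. [folklore] -/
theorem isLevel_kolState (a : ℝ) {N : ℕ} (hN : 1 ≤ N) : IsLevel N (kolState a) := by
  intro k hk
  rw [mFourierCoeff_congr_ae (coe_kolState_ae a), kolField]
  have hk' : k ∉ kolSet := fun hkS => hk (Finset.mem_erase.2 ⟨ne_zero_of_mem_kolSet hkS,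
    Torus.mem_freqBall.2 (by
      rw [freqNormSq_of_mem_kolSet hkS]
      have : (1 : ℝ) ≤ N := by exact_mod_cast hN
      nlinarith)⟩)
  have hnk' : -k ∉ kolSet := fun h => hk' (by simpa using neg_mem_kolSet _ h)
  exact Torus.mFourierCoeff_realTrigPoly_eq_zero_of_not_mem _ hk' hnk'

/-- `‖[K_a]‖²_H = a²/2`. [folklore] -/
theorem norm_sq_kolState (a : ℝ) : ‖kolState a‖ ^ 2 = a ^ 2 / 2 := by
  have h : ‖kolState a‖ = ‖((kolState a).1 : L2T3)‖ := rfl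
  rw [h, ← Torus.integral_norm_sq_coe_eq, ← integral_norm_sq_kolField a]
  exact integral_congr_ae ((coe_kolState_ae a).mono fun x hx => by simp [hx])

/-- **The laminar Dirac is stationary at EVERY order**: all rows of `δ_{[K_a]}` at force
`4π²ν K_a` vanish (any level `N`, any degree `d`). [folklore] -/
theorem isPolyStationary_dirac_kolState (ν a : ℝ) (N d : ℕ) :
    IsPolyStationary ν (kolField (4 * Real.pi ^ 2 * ν * a)) N d (Measure.dirac (kolState a)) := by
  haveI : MeasurableSingletonClass (Torus.energySpace (Fin 3)) :=
    OpensMeasurableSpace.toMeasurableSingletonClass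
  intro m g P hg _
  refine ⟨Torus.integrable_dirac _ _, ?_⟩
  rw [integral_dirac]
  exact nsGeneratorPairing_kolField (coe_kolState_ae a)
    (Torus.isSmooth_sum_smul Finset.univ _ fun i _ => (hg i).1)

/-- Dissipation of the laminar Dirac: `ν‖∇K_a‖² = 2π²νa²`. [folklore] -/
theorem ensembleDissipation_dirac_kolState (ν a : ℝ) :
    Torus.ensembleDissipation ν (Measure.dirac (kolState a)) = ν * (2 * Real.pi ^ 2 * a ^ 2) := by
  haveI : MeasurableSingletonClass (Torus.energySpace (Fin 3)) :=
    OpensMeasurableSpace.toMeasurableSingletonClass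
  unfold Torus.ensembleDissipation Torus.ensembleEnstrophy
  rw [lintegral_dirac, eGradNormSq_congr_ae (coe_kolState_ae a), toReal_eGradNormSq_kolField]

/-- Energy of the laminar Dirac: `a²/2`. [folklore] -/
theorem ensembleEnergy_dirac_kolState (a : ℝ) :
    Torus.ensembleEnergy (Measure.dirac (kolState a)) = a ^ 2 / 2 := by
  haveI : MeasurableSingletonClass (Torus.energySpace (Fin 3)) :=
    OpensMeasurableSpace.toMeasurableSingletonClass
  rw [Torus.ensembleEnergy, integral_dirac, norm_sq_kolState]

/-- The laminar Dirac at amplitude `a = (4π²ν)⁻¹` is a witness for the force `K_1` at every level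
`N ≥ 1`, with energy `a²/2` and dissipation `(8π²ν)⁻¹` — and it ATTAINS the force floor of (C):
`‖K_1‖₂ √(a²/2) = (8π²ν)⁻¹`. [folklore] -/
theorem isQuarticWitness_dirac_kolState {ν : ℝ} (hν : 0 < ν) {N : ℕ} (hN : 1 ≤ N) :
    IsQuarticWitness (kolField 1) ν N ((4 * Real.pi ^ 2 * ν)⁻¹ ^ 2 / 2) (8 * Real.pi ^ 2 * ν)⁻¹
      (Measure.dirac (kolState (4 * Real.pi ^ 2 * ν)⁻¹)) ∧
    Real.sqrt (∫ x, ‖kolField 1 x‖ ^ 2) * Real.sqrt ((4 * Real.pi ^ 2 * ν)⁻¹ ^ 2 / 2) =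
      (8 * Real.pi ^ 2 * ν)⁻¹ := by
  haveI : MeasurableSingletonClass (Torus.energySpace (Fin 3)) :=
    OpensMeasurableSpace.toMeasurableSingletonClass
  have hpi : 0 < Real.pi := Real.pi_pos
  set a : ℝ := (4 * Real.pi ^ 2 * ν)⁻¹ with ha
  have ha0 : 0 < a := by positivity
  have hforce : kolField 1 = kolField (4 * Real.pi ^ 2 * ν * a) := by
    rw [ha, mul_inv_cancel₀ (by positivity)]
  refine ⟨⟨inferInstance, ?_, Torus.integrable_dirac _ _, ?_, ?_, ?_⟩, ?_⟩
  · rw [ae_dirac_eq]; simpa using isLevel_kolState a hN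
  · rw [hforce]; exact isPolyStationary_dirac_kolState ν a N 4
  · rw [ensembleEnergy_dirac_kolState]
  · rw [ensembleDissipation_dirac_kolState, ha]
    field_simp
    ring_nf
    exact le_rfl
  · rw [integral_norm_sq_kolField, ← Real.sqrt_mul (by positivity), show
      (1 : ℝ) ^ 2 / 2 * (a ^ 2 / 2) = (a / 2) ^ 2 by ring, Real.sqrt_sq (by positivity), ha]
    field_simp
    ring

/-- WEAKENING 2 (holds trivially): `QuarticGate` without the energy ceiling `ensembleEnergy μ ≤ E`
(everything else kept, stationarity even at every order). -/
def QuarticGateWithoutEnergyCeiling : Prop :=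
  ∃ f : UnitAddTorus (Fin 3) → EuclideanSpace ℝ (Fin 3),
    Torus.IsSmooth f ∧ Torus.IsDivFree f ∧ Torus.HasZeroMean f ∧
    ∃ (ν : ℕ → ℝ) (ε : ℝ), (∀ j, 0 < ν j) ∧ Tendsto ν atTop (𝓝 0) ∧ 0 < ε ∧
    ∀ j : ℕ, ∃ᶠ N in atTop, ∃ μ : Measure (Torus.energySpace (Fin 3)),
      IsProbabilityMeasure μ ∧ (∀ᵐ u ∂μ, IsLevel N u) ∧
      Integrable (fun u : Torus.energySpace (Fin 3) => ‖u‖ ^ 4) μ ∧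
      (∀ d, IsPolyStationary (ν j) f N d μ) ∧ ε ≤ Torus.ensembleDissipation (ν j) μ

/-- **The energy ceiling is load-bearing**: without it, the laminar Kolmogorov Diracs
`δ_{K_1/(4π²ν_j)}` (exact steady states at EVERY order, level 1, dissipation `(8π²ν_j)⁻¹ → ∞`)
witness the statement for the fixed force `K_1 = cos(2πx₁)e₀`. Any proof of `QuarticGate` must use
`ensembleEnergy μ ≤ E` quantitatively (through (C): `E ≥ (ε/‖f‖₂)²`). [folklore] -/
theorem quarticGateWithoutEnergyCeiling_holds : QuarticGateWithoutEnergyCeiling := by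
  haveI : MeasurableSingletonClass (Torus.energySpace (Fin 3)) :=
    OpensMeasurableSpace.toMeasurableSingletonClass
  have hpi : 0 < Real.pi := Real.pi_pos
  refine ⟨kolField 1, isSmooth_kolField 1, isDivFree_kolField 1, hasZeroMean_kolField 1,
    fun j => 1 / ((j : ℝ) + 1), (8 * Real.pi ^ 2)⁻¹, fun j => by positivity,
    tendsto_one_div_add_atTop_nhds_zero_nat, by positivity, fun j => ?_⟩
  refine (eventually_ge_atTop 1).frequently.mono fun N hN => ?_
  set ν : ℝ := 1 / ((j : ℝ) + 1) with hν
  have hν0 : 0 < ν := by positivity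
  have hν1 : ν ≤ 1 := by
    rw [hν, div_le_one (by positivity)]; linarith [(Nat.cast_nonneg j : (0 : ℝ) ≤ j)]
  set a : ℝ := (4 * Real.pi ^ 2 * ν)⁻¹ with ha
  have hforce : kolField 1 = kolField (4 * Real.pi ^ 2 * ν * a) := by
    rw [ha, mul_inv_cancel₀ (by positivity)]
  refine ⟨Measure.dirac (kolState a), inferInstance, ?_, Torus.integrable_dirac _ _, ?_, ?_⟩
  · rw [ae_dirac_eq]; simpa using isLevel_kolState a hN
  · intro d; rw [hforce]; exact isPolyStationary_dirac_kolState ν a N d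
  · rw [ensembleDissipation_dirac_kolState, ha]
    have h1 : ν * (2 * Real.pi ^ 2 * ((4 * Real.pi ^ 2 * ν)⁻¹) ^ 2) = (8 * Real.pi ^ 2 * ν)⁻¹ := by
      field_simp; ring
    rw [h1]
    exact inv_anti₀ (by positivity) (by nlinarith [hν1, hpi])

end Laminar



end

end Summit.AnomalousDissipation.AnomalousDissipation.Theorems.QuarticGate.Negative
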